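import Summits.HubbardSuperconductivity.HubbardSuperconductivity.Theorems.AnisotropyChordTransferFibre3RowCBand
import Summits.HubbardSuperconductivity.HubbardSuperconductivity.Theorems.AnisotropyChordTransferFibre3RowCL2N27540

/-!
# Route `AnisotropyChord` / H0 rotor rung, LEVEL 2 row C (KT-2b), BANDED η-FACTORISED SHARP program: the cell `ν ∈ [27540, 28091]/10⁶`, `a ∈ [9/100, 121/1000]`

One `(ν, a)`-cell of the `∀L ≥ 128` kernel certificate of the off-pole tail bound (KT-2b″) with the PartN41-E §1 window-shell
cancellation, the η²-factorised evaluation AND the manifold t-band in the `t·R̄` slots (`…RowCBand`: `rowCEFT`):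
★ `cellT27540A0090_rowC` : `RowC.rowCCellCheckFT colN27540 9/100 121/1000 463/100 223/100 (50, 24) = true` (one kernel `decide`), composed with
`RowC.offPoleTail_of_rowCCheckFT`, the column's X-sum bracket `xsN27540` and p2's `colN27540_check`:
★★ `offPoleTailT_cellN27540A0090`: for EVERY `L ≥ 128` and every ground two-magnon profile (`0 ≤ Δ < 1`) with `ν`, `a` in the cell,
`‖R′‖² − P − lowN ≤ (223/100)·η_eff·(2ε₁ − T⁺)·U`.  (Supersedes the crude/sharp constants of `…RowCL2N/L2S27540…` on this cell.)
Prover seat `hubbard-h0-rotor-p1` g28–g29 (route lead); helper for piece A = stmt-HubbardSuperconductivity-23918 of rung 19089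
(`--supports`, helper class).  Nothing here proves superconductivity in the Hubbard model; one kernel-certified piece of ONE
conditional reduction (the GM₃ ∀L certificate, Level-2 row C = KT-2b); the rotor TARGET as originally worded stays FALSE (g15 verdict).
Mathlib + the tree only; no sorry.  Generated by p1 g28–g29 rowc/mkfiles.py (HOME/hubbard-h0-rotor-p1/rowc/).
-/

set_option linter.dupNamespace false
set_option autoImplicit false

open Literature.Analysis.ValidatedNumerics

namespace Summit.HubbardSuperconductivity.HubbardSuperconductivity.Theorems.AnisotropyChord.Transfer.Fibre3.L2.KT2b

open L2.N1

/-- ★ the banded η-factorised sharp row-C `RExpr` cell check passes with `b = 223/100` on `a ∈ [9/100, 121/1000]` over the column `colN27540`. -/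
theorem cellT27540A0090_rowC :
    RowC.rowCCellCheckFT colN27540 ((9 : ℚ) / 100) ((121 : ℚ) / 1000) ((463 : ℚ) / 100) ((223 : ℚ) / 100) (50, 24) = true := by
  decide +kernel

/-- ★★ on this cell, for EVERY `L ≥ 128` and every ground profile: `‖R′‖² − P − lowN ≤ (223/100)·η_eff·(2ε₁ − T⁺)·U`. -/
theorem offPoleTailT_cellN27540A0090 (L : ℕ) [NeZero L] (hL : 128 ≤ L) {Δ lam2 : ℝ} {f : Tor L → ℝ} (hΔ0 : 0 ≤ Δ) (hΔ1 : Δ < 1)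
    (hf : IsGroundTwoMagnon L Δ lam2 f)
    (hν1 : (27540 : ℝ) / 1000000 ≤ lam2 / (2 * Real.pi / L) ^ 2) (hν2 : lam2 / (2 * Real.pi / L) ^ 2 ≤ (28091 : ℝ) / 1000000)
    (ha1 : ((9 : ℝ) / 100) ≤ Δ * f (K1 L)) (ha2 : Δ * f (K1 L) ≤ ((121 : ℝ) / 1000)) :
    (ip L (resid L Δ f) (resid L Δ f)).re - polePart L Δ f - lowNormPart L Δ f
      ≤ ((223 : ℝ) / 100) * etaEff L lam2 * (2 * eps1 L - Tplus L Δ f) * Uunit L Δ f := by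
  have h := RowC.offPoleTail_of_rowCCheckFT L colN27540 ((9 : ℚ) / 100) ((121 : ℚ) / 1000) ((463 : ℚ) / 100) ((223 : ℚ) / 100) (50, 24) 1000000
    cellT27540A0090_rowC colN27540_check xsN27540 hL hΔ0 hΔ1 hf
    (by simpa [colN27540] using hν1) (by simpa [colN27540] using hν2) (by push_cast; simpa using ha1) (by push_cast; simpa using ha2)
  simpa using h

end Summit.HubbardSuperconductivity.HubbardSuperconductivity.Theorems.AnisotropyChord.Transfer.Fibre3.L2.KT2b
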